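import Summits.QuantumFields.BalabanUV.Beta.D1BFx.GhostWordJetLetters
import Summits.QuantumFields.BalabanUV.Beta.D1BFx.NeedleBondMarginal
import Summits.QuantumFields.BalabanUV.Beta.D1BFx.GhostNeedleRootedLetters
import Summits.QuantumFields.BalabanUV.Beta.D1BFx.NeedleRowLetters

/-!
# The «ΔGH» jets, I: the centred weighted mass of the packed `Q′*Q′` vertex is `O(|cQ|)·n⁰`

Road «BF-x» (BetaPertH (D1) dictionary chain), unit `b2b-balaban-beta-d1-formalise-leaf-04` (gen 18), «RK-GH-UNIT» FILE 5b (OWNER RULING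
ρ-g16-2 «ΔGH DIRECT»). The `cQ`-sector of the completed first-order ghost stencil, `SghAt ρ n 0 cQ κ′ u = cQ•qAntiAt ρ n κ′ u`, packed against
the minimiser weights — `V_Q μ y := vertexRedF n (SghAt ρ n 0 cQ) μ y` — has, for every in-block root `ρ` and every rate `0 ≤ σ ≤ κ₁∕(16n)`
(`κ₁ = kappa163 4∕4`), a summable centred weighted ℓ¹-mass at `n•y` bounded by
`|cQ| · 8·e^{κ₁}·(MG163 4·periodConst (kappa163 4) 3·e^{κ₁})·(1 + 16∕κ₁)⁴` — **power `n⁰`** (assembled in FILE 5c from this file's stencil sum).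
THE COUNT: weight envelope `C·n⁻⁵` per stencil (`RestJetEnvelopes.abs_wH_fine_le`); one stencil's weighted mass `≤ e^{σ(8n + 2|u − n•y|₁)}·D(u)`,
`D(u)` the doubled block needle sum (`mass_qAntiAt_stencil_le`); the needle sums are bounded NOT stencil-by-stencil (that costs `n^{κ′}`) but
BLOCK-BY-BLOCK through gan24-leaf-05's bond marginal `NeedleBondMarginal.sum_B_sum_bond_abs_qJetAt_le` (`Σ_{u ∈ B β} D(u) ≤ 2n⁴(n − 1)`), the slow
exponential being constant on a block up to `e^{κ₁∕2}` (`exp_le_blockAvg`): `n⁻⁵ × n⁴(n − 1) × n⁴·(n⁻⁴·Zl 4 (κ₁∕(8n))) ≤ n⁰·(1 + 16∕κ₁)⁴`.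
CONTENT ([folklore]; `B = B6QGQLower276.B (n − 1)`, `blk = blk (n − 1)`): §1 `exp_pair_le`, `qAntiAt_eq_zero_of_not_blk`, **`mass_qAntiAt_stencil_le`**, `SghAt_Q_eq_smul`,
`sum_B_D_le`, `D_le`; §2 `abs_wH_mul_exp_le`, `exp_le_blockAvg`, **`tsum_wH_stencilMass_le`** (the vertex itself: FILE 5c `GhostDeltaJetMasses`).
0 sorry ∕ new def ∕ `def … : Prop` ∕ cite. HONEST: estimates about OUR packed objects; 0 root-level binders discharged; (K) NOT closed; NOT D1,
NOT BetaPertH, NOT continuum, NOT Clay.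
-/


open Finset
open scoped BigOperators
open Literature.MathematicalPhysics.QuantumFieldTheory.Balaban1983to89
open Literature.MathematicalPhysics.QuantumFieldTheory.Balaban1983to89.Beta
open B12Sec2to5 (l1 l1_nonneg)
open B5Hk163Strip (kappa163 kappa163_pos)
open B5Hk163Decay (MG163)
open B4TorusKernel (periodConst)
open B6QGQLower276 (blk B mem_B)
open ExpKernelCalculus (Site MKer Zl Zl_nonneg tsum_exp_shift' summable_exp_shift' l1_sub_triangle l1_sub_symm)
open KernelSpecInstance (wH)
open Summit.QuantumFields.BalabanUV.Beta.D1BFx.GhostStencil (ghCur l1_sub_le_of_blk_eq)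
open Summit.QuantumFields.BalabanUV.Beta.D1BFx.GhostStencilRooted (qJetAt qAntiAt qAntiAt_apply qJetAt_eq_zero SghAt SghAt_apply)
open Summit.QuantumFields.BalabanUV.Beta.D1BFx.GhostNeedleRootedLetters (abs_qJetAt_le_inv_pow_four sum_B_const')
open Summit.QuantumFields.BalabanUV.Beta.D1BFx.NeedleBondMarginal (sum_B_sum_bond_abs_qJetAt_le)
open Summit.QuantumFields.BalabanUV.Beta.D1BFx.NeedleRowLetters (tsum_eq_tsum_blocks hasSum_blocks)
open Summit.QuantumFields.BalabanUV.Beta.D1BFx.RestJetEnvelopes (abs_wH_fine_le)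
open Summit.QuantumFields.BalabanUV.Beta.D1BFx.GhostWordJetLetters (wH_const_nonneg Zl_kappa_le)

namespace Summit.QuantumFields.BalabanUV.Beta.D1BFx.GhostDeltaJetLetters

/-! ## §1 One stencil: the weighted mass of `qAntiAt ρ n κ′ u` and the block needle totals -/

section Stencil
variable (ρ : Site 4) (n : ℕ) [NeZero n] (κ' : Fin 4)

/-- [folklore] At two block-mates `x`, `z` of `u` the centred pair weight is at most `e^{σ((4n + |u − c|₁) + (4n + |u − c|₁))}` (`0 ≤ σ`). -/
theorem exp_pair_le {σ : ℝ} (hσ : 0 ≤ σ) (c u : Site 4) {x z : Site 4} (hx : blk (n - 1) x = blk (n - 1) u) (hz : blk (n - 1) z = blk (n - 1) u) :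
    Real.exp (σ * (l1 (x - c) + l1 (z - c))) ≤ Real.exp (σ * ((4 * (n : ℝ) + l1 (u - c)) + (4 * (n : ℝ) + l1 (u - c)))) := by
  have h1 : l1 (x - c) ≤ 4 * (n : ℝ) + l1 (u - c) := (l1_sub_triangle x u c).trans (by have := l1_sub_le_of_blk_eq n hx; linarith)
  have h2 : l1 (z - c) ≤ 4 * (n : ℝ) + l1 (u - c) := (l1_sub_triangle z u c).trans (by have := l1_sub_le_of_blk_eq n hz; linarith)
  exact Real.exp_le_exp.2 (mul_le_mul_of_nonneg_left (add_le_add h1 h2) hσ)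

omit [NeZero n] in
/-- [folklore] The stripped kernel lives on the block square of its bond: off `blk x = blk u ∧ blk z = blk u` it vanishes (both rooted jets'
guards fail). -/
theorem qAntiAt_eq_zero_of_not_blk (u : Site 4) {x z : Site 4} (h : ¬(blk (n - 1) x = blk (n - 1) u ∧ blk (n - 1) z = blk (n - 1) u))
    (a b : Unit) : qAntiAt ρ n κ' u x z a b = 0 := by
  have h1 : qJetAt ρ n κ' u (blk (n - 1) x) z = 0 := qJetAt_eq_zero ρ n κ' u fun hh => h ⟨hh.2.symm, hh.1.trans hh.2.symm⟩
  have h2 : qJetAt ρ n κ' u (blk (n - 1) z) x = 0 := qJetAt_eq_zero ρ n κ' u fun hh => h ⟨hh.1.trans hh.2.symm, hh.2.symm⟩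
  rw [qAntiAt_apply, h1, h2, sub_zero]

/-- [folklore] **ONE STENCIL'S WEIGHTED MASS**: the stripped kernel `qAntiAt ρ n κ′ u` lives on the block of `u` in both arguments, so its centred
weighted mass (centre `c`, rate `σ ≥ 0`) is summable and at most `e^{σ((4n + |u − c|₁) + (4n + |u − c|₁))} · D(u)` with the doubled block needle sum
`D(u) := Σ_{x ∈ B(blk u)} Σ_{z ∈ B(blk u)} (|qJetAt ρ n κ′ u (blk u) z| + |qJetAt ρ n κ′ u (blk u) x|)`. -/
theorem mass_qAntiAt_stencil_le {σ : ℝ} (hσ : 0 ≤ σ) (c u : Site 4) :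
    (Summable fun p : Site 4 × Site 4 => ∑ a, ∑ b, |qAntiAt ρ n κ' u p.1 p.2 a b| * Real.exp (σ * (l1 (p.1 - c) + l1 (p.2 - c)))) ∧
      ∑' p : Site 4 × Site 4, ∑ a, ∑ b, |qAntiAt ρ n κ' u p.1 p.2 a b| * Real.exp (σ * (l1 (p.1 - c) + l1 (p.2 - c)))
        ≤ Real.exp (σ * ((4 * (n : ℝ) + l1 (u - c)) + (4 * (n : ℝ) + l1 (u - c)))) *
          ∑ x ∈ B (n - 1) (blk (n - 1) u), ∑ z ∈ B (n - 1) (blk (n - 1) u),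
            (|qJetAt ρ n κ' u (blk (n - 1) u) z| + |qJetAt ρ n κ' u (blk (n - 1) u) x|) := by
  set W : ℝ := Real.exp (σ * ((4 * (n : ℝ) + l1 (u - c)) + (4 * (n : ℝ) + l1 (u - c)))) with hW
  -- the majorant, supported on the block square of `u`
  set g : Site 4 × Site 4 → ℝ := fun p => if blk (n - 1) p.1 = blk (n - 1) u ∧ blk (n - 1) p.2 = blk (n - 1) u then
      W * (|qJetAt ρ n κ' u (blk (n - 1) u) p.2| + |qJetAt ρ n κ' u (blk (n - 1) u) p.1|) else 0 with hg
  have hg0 : ∀ p, p ∉ B (n - 1) (blk (n - 1) u) ×ˢ B (n - 1) (blk (n - 1) u) → g p = 0 := by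
    rintro ⟨x, z⟩ hp
    have h : ¬(blk (n - 1) x = blk (n - 1) u ∧ blk (n - 1) z = blk (n - 1) u) := fun h => hp (Finset.mem_product.2 ⟨mem_B.2 h.1, mem_B.2 h.2⟩)
    simp only [hg, if_neg h]
  have hgs : Summable g := summable_of_ne_finset_zero hg0
  have hnn : ∀ p : Site 4 × Site 4, 0 ≤ ∑ a, ∑ b, |qAntiAt ρ n κ' u p.1 p.2 a b| * Real.exp (σ * (l1 (p.1 - c) + l1 (p.2 - c))) :=
    fun p => Finset.sum_nonneg fun a _ => Finset.sum_nonneg fun b _ => by positivity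
  have hle : ∀ p : Site 4 × Site 4, ∑ a, ∑ b, |qAntiAt ρ n κ' u p.1 p.2 a b| * Real.exp (σ * (l1 (p.1 - c) + l1 (p.2 - c))) ≤ g p := by
    rintro ⟨x, z⟩
    rw [Fintype.sum_unique, Fintype.sum_unique]
    show |qAntiAt ρ n κ' u x z () ()| * Real.exp (σ * (l1 (x - c) + l1 (z - c))) ≤ g (x, z)
    by_cases h : blk (n - 1) x = blk (n - 1) u ∧ blk (n - 1) z = blk (n - 1) u
    · simp only [hg, if_pos h]
      have hq : |qAntiAt ρ n κ' u x z () ()| ≤ |qJetAt ρ n κ' u (blk (n - 1) u) z| + |qJetAt ρ n κ' u (blk (n - 1) u) x| := by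
        rw [qAntiAt_apply, h.1, h.2]; exact abs_sub _ _
      calc |qAntiAt ρ n κ' u x z () ()| * Real.exp (σ * (l1 (x - c) + l1 (z - c)))
          ≤ (|qJetAt ρ n κ' u (blk (n - 1) u) z| + |qJetAt ρ n κ' u (blk (n - 1) u) x|) * W :=
            mul_le_mul hq (exp_pair_le n hσ c u h.1 h.2) (Real.exp_pos _).le (by positivity)
        _ = W * (|qJetAt ρ n κ' u (blk (n - 1) u) z| + |qJetAt ρ n κ' u (blk (n - 1) u) x|) := mul_comm _ _
    · simp only [hg, if_neg h]
      rw [qAntiAt_eq_zero_of_not_blk ρ n κ' u h, abs_zero, zero_mul]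
  have hsum := Summable.of_nonneg_of_le hnn hle hgs
  refine ⟨hsum, (hsum.tsum_le_tsum hle hgs).trans (le_of_eq ?_)⟩
  rw [tsum_eq_sum (s := B (n - 1) (blk (n - 1) u) ×ˢ B (n - 1) (blk (n - 1) u)) (fun p hp => hg0 p hp), Finset.mul_sum,
    Finset.sum_product]
  refine Finset.sum_congr rfl fun x hx => ?_
  rw [Finset.mul_sum]
  refine Finset.sum_congr rfl fun z hz => ?_
  simp only [hg, if_pos (And.intro (mem_B.1 hx) (mem_B.1 hz))]

omit [NeZero n] in
/-- [folklore] The `cQ`-sector of the completed stencil is a scalar multiple of the stripped kernel: `SghAt ρ n 0 cQ κ′ u = cQ • qAntiAt ρ n κ′ u`. -/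
theorem SghAt_Q_eq_smul (cQ : ℝ) (u : Site 4) : SghAt ρ n 0 cQ κ' u = cQ • qAntiAt ρ n κ' u := by
  funext x z a b
  rw [SghAt_apply, Pi.smul_apply, Pi.smul_apply, Pi.smul_apply, Pi.smul_apply, smul_eq_mul, zero_mul, zero_add]

/-- [folklore] **THE BLOCK NEEDLE TOTAL** (gan24-leaf-05's bond marginal, both orientations): for an in-block root,
`Σ_{u ∈ B β} D_β(u) ≤ 2·(n⁴·(n⁴·((n − 1)·n⁻⁴)))` (`= 2n⁴(n − 1)`), where `D_β(u) := Σ_{x ∈ B β} Σ_{z ∈ B β} (|qJetAt u β z| + |qJetAt u β x|)`. -/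
theorem sum_B_D_le {ρ : Site 4} (hρ : ∀ i : Fin 4, 0 ≤ ρ i ∧ ρ i < n) (β : Site 4) :
    ∑ u ∈ B (n - 1) β, ∑ x ∈ B (n - 1) β, ∑ z ∈ B (n - 1) β, (|qJetAt ρ n κ' u β z| + |qJetAt ρ n κ' u β x|)
      ≤ 2 * ((n : ℝ) ^ 4 * ((n : ℝ) ^ 4 * (((n : ℝ) - 1) * ((n : ℝ) ^ 4)⁻¹))) := by
  have hM := sum_B_sum_bond_abs_qJetAt_le n κ' hρ (B (n - 1) β) β
  have e1 : ∑ u ∈ B (n - 1) β, ∑ x ∈ B (n - 1) β, ∑ z ∈ B (n - 1) β, |qJetAt ρ n κ' u β z|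
      = (n : ℝ) ^ 4 * ∑ z ∈ B (n - 1) β, ∑ u ∈ B (n - 1) β, |qJetAt ρ n κ' u β z| := by
    rw [Finset.sum_comm (s := B (n - 1) β) (t := B (n - 1) β), sum_B_const', Finset.sum_comm]
  have e2 : ∑ u ∈ B (n - 1) β, ∑ x ∈ B (n - 1) β, ∑ z ∈ B (n - 1) β, |qJetAt ρ n κ' u β x|
      = (n : ℝ) ^ 4 * ∑ x ∈ B (n - 1) β, ∑ u ∈ B (n - 1) β, |qJetAt ρ n κ' u β x| := by
    rw [Finset.sum_comm (s := B (n - 1) β) (t := B (n - 1) β), Finset.mul_sum]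
    refine Finset.sum_congr rfl fun x _ => ?_
    rw [Finset.sum_comm, sum_B_const']
  have hn : (0 : ℝ) ≤ (n : ℝ) ^ 4 := by positivity
  calc ∑ u ∈ B (n - 1) β, ∑ x ∈ B (n - 1) β, ∑ z ∈ B (n - 1) β, (|qJetAt ρ n κ' u β z| + |qJetAt ρ n κ' u β x|)
      = (n : ℝ) ^ 4 * ∑ z ∈ B (n - 1) β, ∑ u ∈ B (n - 1) β, |qJetAt ρ n κ' u β z|
          + (n : ℝ) ^ 4 * ∑ x ∈ B (n - 1) β, ∑ u ∈ B (n - 1) β, |qJetAt ρ n κ' u β x| := by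
        have hs : ∑ u ∈ B (n - 1) β, ∑ x ∈ B (n - 1) β, ∑ z ∈ B (n - 1) β, (|qJetAt ρ n κ' u β z| + |qJetAt ρ n κ' u β x|)
            = ∑ u ∈ B (n - 1) β, ∑ x ∈ B (n - 1) β, ∑ z ∈ B (n - 1) β, |qJetAt ρ n κ' u β z|
              + ∑ u ∈ B (n - 1) β, ∑ x ∈ B (n - 1) β, ∑ z ∈ B (n - 1) β, |qJetAt ρ n κ' u β x| := by
          rw [← Finset.sum_add_distrib]
          refine Finset.sum_congr rfl fun u _ => ?_
          rw [← Finset.sum_add_distrib]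
          refine Finset.sum_congr rfl fun x _ => ?_
          rw [← Finset.sum_add_distrib]
        rw [hs, e1, e2]
    _ ≤ (n : ℝ) ^ 4 * ((n : ℝ) ^ 4 * (((n : ℝ) - 1) * ((n : ℝ) ^ 4)⁻¹)) + (n : ℝ) ^ 4 * ((n : ℝ) ^ 4 * (((n : ℝ) - 1) * ((n : ℝ) ^ 4)⁻¹)) :=
        add_le_add (mul_le_mul_of_nonneg_left hM hn) (mul_le_mul_of_nonneg_left hM hn)
    _ = 2 * ((n : ℝ) ^ 4 * ((n : ℝ) ^ 4 * (((n : ℝ) - 1) * ((n : ℝ) ^ 4)⁻¹))) := by ring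

/-- [folklore] The crude stencil-wise bound `D(u) ≤ n⁴·(n⁴·(2·n⁻⁴))` (`= 2n⁴`; `|qJetAt| ≤ n⁻⁴`), used only for summability. -/
theorem D_le (u β : Site 4) :
    ∑ x ∈ B (n - 1) β, ∑ z ∈ B (n - 1) β, (|qJetAt ρ n κ' u β z| + |qJetAt ρ n κ' u β x|)
      ≤ (n : ℝ) ^ 4 * ((n : ℝ) ^ 4 * (2 * ((n : ℝ) ^ 4)⁻¹)) := by
  calc ∑ x ∈ B (n - 1) β, ∑ z ∈ B (n - 1) β, (|qJetAt ρ n κ' u β z| + |qJetAt ρ n κ' u β x|)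
      ≤ ∑ _x ∈ B (n - 1) β, ∑ _z ∈ B (n - 1) β, 2 * ((n : ℝ) ^ 4)⁻¹ :=
        Finset.sum_le_sum fun x _ => Finset.sum_le_sum fun z _ => by
          have h1 := abs_qJetAt_le_inv_pow_four ρ n κ' u β z; have h2 := abs_qJetAt_le_inv_pow_four ρ n κ' u β x; linarith
    _ = (n : ℝ) ^ 4 * ((n : ℝ) ^ 4 * (2 * ((n : ℝ) ^ 4)⁻¹)) := by rw [sum_B_const', sum_B_const']

end Stencil

/-! ## §2 The stencil sum against the minimiser weight -/

section StencilSum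
variable (m : ℕ)

/-- [folklore] **ONE WEIGHT AGAINST THE SLOW EXPONENTIAL**, termwise (`GhostWordJetLetters.tsum_abs_wH_mul_exp_le`'s majorant): for `σ ≤ κ₁∕(16n)`,
`|wH κ l (u − n•y)|·e^{2σ|u − n•y|₁} ≤ C·e^{−(κ₁∕(8n))|u − n•y|₁}`, `C = n⁻⁵·M·P·e^{κ₁}`. -/
theorem abs_wH_mul_exp_le {σ : ℝ} (hσ : σ ≤ kappa163 (3 + 1) / (3 + 1) / (16 * ((m + 1 : ℕ) : ℝ))) (κ l : Fin 4) (y u : Site 4) :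
    |wH (d := 3) (N := m + 1) κ l (u - ((m + 1 : ℕ) : ℤ) • y)| * Real.exp (2 * σ * l1 (u - ((m + 1 : ℕ) : ℤ) • y))
      ≤ ((((m + 1 : ℕ) : ℝ)) ^ (3 + 2))⁻¹ * (MG163 (3 + 1) * periodConst (kappa163 (3 + 1)) 3) * Real.exp (kappa163 (3 + 1) / (3 + 1))
        * Real.exp (-(kappa163 (3 + 1) / (3 + 1) / (8 * ((m + 1 : ℕ) : ℝ))) * l1 (u - ((m + 1 : ℕ) : ℤ) • y)) := by
  set C : ℝ := ((((m + 1 : ℕ) : ℝ)) ^ (3 + 2))⁻¹ * (MG163 (3 + 1) * periodConst (kappa163 (3 + 1)) 3) * Real.exp (kappa163 (3 + 1) / (3 + 1)) with hC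
  have hC0 : 0 ≤ C := wH_const_nonneg m
  have hn : (0 : ℝ) < ((m + 1 : ℕ) : ℝ) := by exact_mod_cast Nat.succ_pos m
  have hκ := kappa163_pos (3 + 1)
  have hr : 0 < kappa163 (3 + 1) / (3 + 1) / (8 * ((m + 1 : ℕ) : ℝ)) := by positivity
  set c : Site 4 := ((m + 1 : ℕ) : ℤ) • y with hc
  have h1 := abs_wH_fine_le m κ l u y
  rw [← hc] at h1
  have hl := l1_nonneg (u - c)
  calc |wH (d := 3) (N := m + 1) κ l (u - c)| * Real.exp (2 * σ * l1 (u - c))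
      ≤ (C * Real.exp (-(kappa163 (3 + 1) / (3 + 1) / (4 * ((m + 1 : ℕ) : ℝ))) * l1 (u - c))) * Real.exp (2 * σ * l1 (u - c)) :=
        mul_le_mul_of_nonneg_right h1 (Real.exp_pos _).le
    _ = C * Real.exp (-(kappa163 (3 + 1) / (3 + 1) / (4 * ((m + 1 : ℕ) : ℝ))) * l1 (u - c) + 2 * σ * l1 (u - c)) := by
        rw [Real.exp_add]; ring
    _ ≤ C * Real.exp (-(kappa163 (3 + 1) / (3 + 1) / (8 * ((m + 1 : ℕ) : ℝ))) * l1 (u - c)) := by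
        refine mul_le_mul_of_nonneg_left (Real.exp_le_exp.2 ?_) hC0
        have e8 : kappa163 (3 + 1) / (3 + 1) / (4 * ((m + 1 : ℕ) : ℝ)) = 2 * (kappa163 (3 + 1) / (3 + 1) / (8 * ((m + 1 : ℕ) : ℝ))) := by
          field_simp; ring
        have e16 : kappa163 (3 + 1) / (3 + 1) / (16 * ((m + 1 : ℕ) : ℝ)) = (kappa163 (3 + 1) / (3 + 1) / (8 * ((m + 1 : ℕ) : ℝ))) / 2 := by
          field_simp; ring
        rw [e16] at hσ
        rw [e8]
        nlinarith [hl, hr]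

/-- [folklore] **BLOCK AVERAGING OF THE SLOW EXPONENTIAL**: two sites of one block are `4n` apart in `ℓ¹`, and `(κ₁∕(8n))·4n = κ₁∕2`, so
`e^{−(κ₁∕(8n))|u − c|₁} ≤ e^{κ₁∕2} · n⁻⁴ · Σ_{u′ ∈ B(blk u)} e^{−(κ₁∕(8n))|u′ − c|₁}`. -/
theorem exp_le_blockAvg (c u : Site 4) :
    Real.exp (-(kappa163 (3 + 1) / (3 + 1) / (8 * ((m + 1 : ℕ) : ℝ))) * l1 (u - c))
      ≤ Real.exp (kappa163 (3 + 1) / (3 + 1) / 2) * (((((m + 1 : ℕ) : ℝ)) ^ 4)⁻¹ *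
          ∑ u' ∈ B (m + 1 - 1) (blk (m + 1 - 1) u), Real.exp (-(kappa163 (3 + 1) / (3 + 1) / (8 * ((m + 1 : ℕ) : ℝ))) * l1 (u' - c))) := by
  set r : ℝ := kappa163 (3 + 1) / (3 + 1) / (8 * ((m + 1 : ℕ) : ℝ)) with hr
  have hn : (0 : ℝ) < ((m + 1 : ℕ) : ℝ) := by exact_mod_cast Nat.succ_pos m
  have hκ := kappa163_pos (3 + 1)
  have hr0 : 0 < r := by positivity
  have hrn : r * (4 * ((m + 1 : ℕ) : ℝ)) = kappa163 (3 + 1) / (3 + 1) / 2 := by rw [hr]; field_simp; ring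
  -- every block-mate `u′` of `u`: `e^{−r|u − c|} ≤ e^{κ₁/2}·e^{−r|u′ − c|}`
  have hcmp : ∀ u' ∈ B (m + 1 - 1) (blk (m + 1 - 1) u), Real.exp (-r * l1 (u - c)) ≤ Real.exp (kappa163 (3 + 1) / (3 + 1) / 2) * Real.exp (-r * l1 (u' - c)) := by
    intro u' hu'
    have h4 : l1 (u' - u) ≤ 4 * ((m + 1 : ℕ) : ℝ) := l1_sub_le_of_blk_eq (m + 1) (mem_B.1 hu')
    have ht : l1 (u' - c) ≤ l1 (u' - u) + l1 (u - c) := l1_sub_triangle u' u c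
    rw [← Real.exp_add]
    refine Real.exp_le_exp.2 ?_
    nlinarith [hr0, h4, ht]
  have hsum : (((m + 1 : ℕ) : ℝ)) ^ 4 * Real.exp (-r * l1 (u - c))
      ≤ Real.exp (kappa163 (3 + 1) / (3 + 1) / 2) * ∑ u' ∈ B (m + 1 - 1) (blk (m + 1 - 1) u), Real.exp (-r * l1 (u' - c)) := by
    have e : (((m + 1 : ℕ) : ℝ)) ^ 4 * Real.exp (-r * l1 (u - c)) = ∑ _u' ∈ B (m + 1 - 1) (blk (m + 1 - 1) u), Real.exp (-r * l1 (u - c)) := by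
      rw [sum_B_const' (m + 1)]
    rw [e, Finset.mul_sum]
    exact Finset.sum_le_sum hcmp
  have hn4 : (0 : ℝ) < (((m + 1 : ℕ) : ℝ)) ^ 4 := by positivity
  calc Real.exp (-r * l1 (u - c)) = ((((m + 1 : ℕ) : ℝ)) ^ 4)⁻¹ * ((((m + 1 : ℕ) : ℝ)) ^ 4 * Real.exp (-r * l1 (u - c))) := by
        rw [← mul_assoc, inv_mul_cancel₀ hn4.ne', one_mul]
    _ ≤ ((((m + 1 : ℕ) : ℝ)) ^ 4)⁻¹ * (Real.exp (kappa163 (3 + 1) / (3 + 1) / 2) * ∑ u' ∈ B (m + 1 - 1) (blk (m + 1 - 1) u), Real.exp (-r * l1 (u' - c))) :=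
        mul_le_mul_of_nonneg_left hsum (inv_nonneg.2 hn4.le)
    _ = _ := by ring

/-- [folklore] **THE STENCIL SUM AGAINST THE MINIMISER WEIGHT** — the heart of the count: for an in-block root `ρ`, `0 ≤ σ ≤ κ₁∕(16n)` and the
stencil masses `ρ_u := |cQ|·(e^{σ((4n + |u − c|₁) + (4n + |u − c|₁))}·D(u))` of §1 (`c = n•y`, `σ ≤ κ₁∕(16n)`),
`Σ'_u |wH κ′ μ (u − c)|·ρ_u ≤ |cQ| · 2·e^{κ₁}·(M·P·e^{κ₁})·(1 + 16∕κ₁)⁴` — `n⁻⁵ × n⁴(n − 1) × n⁴·(1 + 16∕κ₁)⁴·n⁻⁴ ≤ n⁰`. -/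
theorem tsum_wH_stencilMass_le {ρ : Site 4} (hρ : ∀ i : Fin 4, 0 ≤ ρ i ∧ ρ i < (m + 1 : ℕ)) {σ : ℝ}
    (hσ : σ ≤ kappa163 (3 + 1) / (3 + 1) / (16 * ((m + 1 : ℕ) : ℝ))) (κ' μ : Fin 4) (y : Site 4) (cQ : ℝ) :
    (Summable fun u : Site 4 => |wH (d := 3) (N := m + 1) κ' μ (u - ((m + 1 : ℕ) : ℤ) • y)| *
        (|cQ| * (Real.exp (σ * ((4 * (((m + 1 : ℕ) : ℕ) : ℝ) + l1 (u - ((m + 1 : ℕ) : ℤ) • y)) + (4 * (((m + 1 : ℕ) : ℕ) : ℝ) + l1 (u - ((m + 1 : ℕ) : ℤ) • y)))) *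
          ∑ x ∈ B ((m + 1 : ℕ) - 1) (blk ((m + 1 : ℕ) - 1) u), ∑ z ∈ B ((m + 1 : ℕ) - 1) (blk ((m + 1 : ℕ) - 1) u),
            (|qJetAt ρ (m + 1) κ' u (blk ((m + 1 : ℕ) - 1) u) z| + |qJetAt ρ (m + 1) κ' u (blk ((m + 1 : ℕ) - 1) u) x|)))) ∧
      ∑' u : Site 4, |wH (d := 3) (N := m + 1) κ' μ (u - ((m + 1 : ℕ) : ℤ) • y)| *
        (|cQ| * (Real.exp (σ * ((4 * (((m + 1 : ℕ) : ℕ) : ℝ) + l1 (u - ((m + 1 : ℕ) : ℤ) • y)) + (4 * (((m + 1 : ℕ) : ℕ) : ℝ) + l1 (u - ((m + 1 : ℕ) : ℤ) • y)))) *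
          ∑ x ∈ B ((m + 1 : ℕ) - 1) (blk ((m + 1 : ℕ) - 1) u), ∑ z ∈ B ((m + 1 : ℕ) - 1) (blk ((m + 1 : ℕ) - 1) u),
            (|qJetAt ρ (m + 1) κ' u (blk ((m + 1 : ℕ) - 1) u) z| + |qJetAt ρ (m + 1) κ' u (blk ((m + 1 : ℕ) - 1) u) x|)))
        ≤ |cQ| * (2 * Real.exp (kappa163 (3 + 1) / (3 + 1)) *
            ((MG163 (3 + 1) * periodConst (kappa163 (3 + 1)) 3) * Real.exp (kappa163 (3 + 1) / (3 + 1))) * (1 + 16 / (kappa163 (3 + 1) / (3 + 1))) ^ 4) := by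
  set n : ℕ := m + 1 with hn
  set C : ℝ := ((((m + 1 : ℕ) : ℝ)) ^ (3 + 2))⁻¹ * (MG163 (3 + 1) * periodConst (kappa163 (3 + 1)) 3) * Real.exp (kappa163 (3 + 1) / (3 + 1)) with hC
  have hC0 : 0 ≤ C := wH_const_nonneg m
  have hn0 : (0 : ℝ) < ((m + 1 : ℕ) : ℝ) := by exact_mod_cast Nat.succ_pos m
  have hn1 : (1 : ℝ) ≤ ((m + 1 : ℕ) : ℝ) := by exact_mod_cast Nat.le_add_left 1 m
  have hκ := kappa163_pos (3 + 1)
  set r : ℝ := kappa163 (3 + 1) / (3 + 1) / (8 * ((m + 1 : ℕ) : ℝ)) with hr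
  have hr0 : 0 < r := by positivity
  set c : Site 4 := ((m + 1 : ℕ) : ℤ) • y with hc
  -- the letters of the sum
  set D : Site 4 → ℝ := fun u => ∑ x ∈ B (n - 1) (blk (n - 1) u), ∑ z ∈ B (n - 1) (blk (n - 1) u),
      (|qJetAt ρ n κ' u (blk (n - 1) u) z| + |qJetAt ρ n κ' u (blk (n - 1) u) x|) with hD
  set E : Site 4 → ℝ := fun β => ∑ u' ∈ B (n - 1) β, Real.exp (-r * l1 (u' - c)) with hE
  set S : Site 4 → ℝ := fun u => |wH (d := 3) (N := m + 1) κ' μ (u - c)| *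
      (|cQ| * (Real.exp (σ * ((4 * ((n : ℕ) : ℝ) + l1 (u - c)) + (4 * ((n : ℕ) : ℝ) + l1 (u - c)))) * D u)) with hS
  show Summable S ∧ ∑' u, S u ≤ _
  have hD0 : ∀ u, 0 ≤ D u := fun u => Finset.sum_nonneg fun x _ => Finset.sum_nonneg fun z _ => by positivity
  have hE0 : ∀ β, 0 ≤ E β := fun β => Finset.sum_nonneg fun u _ => (Real.exp_pos _).le
  have hS0 : ∀ u, 0 ≤ S u := fun u => by simp only [hS]; exact mul_nonneg (abs_nonneg _) (mul_nonneg (abs_nonneg _) (mul_nonneg (Real.exp_pos _).le (hD0 u)))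
  -- (B) the block-independent part of the weight: `e^{σ·8n} ≤ e^{κ₁/2}`
  have h8 : Real.exp (σ * (8 * ((n : ℕ) : ℝ))) ≤ Real.exp (kappa163 (3 + 1) / (3 + 1) / 2) := by
    refine Real.exp_le_exp.2 ?_
    have h := mul_le_mul_of_nonneg_right hσ (by positivity : (0 : ℝ) ≤ 8 * ((m + 1 : ℕ) : ℝ))
    have e : kappa163 (3 + 1) / (3 + 1) / (16 * ((m + 1 : ℕ) : ℝ)) * (8 * ((m + 1 : ℕ) : ℝ)) = kappa163 (3 + 1) / (3 + 1) / 2 := by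
      field_simp; ring
    rw [e] at h; rw [hn]; exact h
  have hsplit : ∀ u, Real.exp (σ * ((4 * ((n : ℕ) : ℝ) + l1 (u - c)) + (4 * ((n : ℕ) : ℝ) + l1 (u - c))))
      = Real.exp (σ * (8 * ((n : ℕ) : ℝ))) * Real.exp (2 * σ * l1 (u - c)) := fun u => by rw [← Real.exp_add]; ring_nf
  -- (A)+(B): `S u ≤ |cQ|·e^{κ₁/2}·C·e^{−r|u − c|}·D u`
  have hS1 : ∀ u, S u ≤ |cQ| * Real.exp (kappa163 (3 + 1) / (3 + 1) / 2) * (C * Real.exp (-r * l1 (u - c))) * D u := by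
    intro u
    have hA := abs_wH_mul_exp_le m hσ κ' μ y u
    rw [← hc] at hA
    calc S u = |cQ| * Real.exp (σ * (8 * ((n : ℕ) : ℝ))) *
          (|wH (d := 3) (N := m + 1) κ' μ (u - c)| * Real.exp (2 * σ * l1 (u - c))) * D u := by simp only [hS, hsplit]; ring
      _ ≤ |cQ| * Real.exp (kappa163 (3 + 1) / (3 + 1) / 2) * (C * Real.exp (-r * l1 (u - c))) * D u := by
          refine mul_le_mul_of_nonneg_right ?_ (hD0 u)
          exact mul_le_mul (mul_le_mul_of_nonneg_left h8 (abs_nonneg _)) hA (by positivity) (by positivity)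
  -- summability from the crude `D u ≤ 2n⁴`
  have hDcr : ∀ u, D u ≤ ((n : ℕ) : ℝ) ^ 4 * (((n : ℕ) : ℝ) ^ 4 * (2 * (((n : ℕ) : ℝ) ^ 4)⁻¹)) := fun u => D_le ρ n κ' u (blk (n - 1) u)
  have hmaj : Summable fun u => |cQ| * Real.exp (kappa163 (3 + 1) / (3 + 1) / 2) * (C * Real.exp (-r * l1 (u - c))) *
      (((n : ℕ) : ℝ) ^ 4 * (((n : ℕ) : ℝ) ^ 4 * (2 * (((n : ℕ) : ℝ) ^ 4)⁻¹))) := by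
    have h := ((summable_exp_shift' hr0 c).mul_left (|cQ| * Real.exp (kappa163 (3 + 1) / (3 + 1) / 2) * C)).mul_right
      (((n : ℕ) : ℝ) ^ 4 * (((n : ℕ) : ℝ) ^ 4 * (2 * (((n : ℕ) : ℝ) ^ 4)⁻¹)))
    refine h.congr fun u => ?_
    ring
  have hSs : Summable S := Summable.of_nonneg_of_le hS0 (fun u => (hS1 u).trans
    (mul_le_mul_of_nonneg_left (hDcr u) (by positivity))) hmaj
  refine ⟨hSs, ?_⟩
  -- (C) block averaging: on the block `β`, `S u ≤ |cQ|·e^{κ₁}·C·n⁻⁴·E β·D u`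
  have eκ : Real.exp (kappa163 (3 + 1) / (3 + 1) / 2) * Real.exp (kappa163 (3 + 1) / (3 + 1) / 2) = Real.exp (kappa163 (3 + 1) / (3 + 1)) := by
    rw [← Real.exp_add]; ring_nf
  have hS2 : ∀ β, ∀ u ∈ B (n - 1) β, S u ≤ |cQ| * Real.exp (kappa163 (3 + 1) / (3 + 1)) * C * (((((m + 1 : ℕ) : ℝ)) ^ 4)⁻¹ * E β) *
      ∑ x ∈ B (n - 1) β, ∑ z ∈ B (n - 1) β, (|qJetAt ρ n κ' u β z| + |qJetAt ρ n κ' u β x|) := by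
    intro β u hu
    have hβ : blk (n - 1) u = β := mem_B.1 hu
    have hav := exp_le_blockAvg m c u
    rw [← hr] at hav
    have hDu : D u = ∑ x ∈ B (n - 1) β, ∑ z ∈ B (n - 1) β, (|qJetAt ρ n κ' u β z| + |qJetAt ρ n κ' u β x|) := by simp only [hD, hβ]
    have hEu : ∑ u' ∈ B (m + 1 - 1) (blk (m + 1 - 1) u), Real.exp (-r * l1 (u' - c)) = E β := by simp only [hE, hn] at hβ ⊢; rw [hβ]
    rw [hEu] at hav
    calc S u ≤ |cQ| * Real.exp (kappa163 (3 + 1) / (3 + 1) / 2) * (C * Real.exp (-r * l1 (u - c))) * D u := hS1 u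
      _ ≤ |cQ| * Real.exp (kappa163 (3 + 1) / (3 + 1) / 2) *
            (C * (Real.exp (kappa163 (3 + 1) / (3 + 1) / 2) * (((((m + 1 : ℕ) : ℝ)) ^ 4)⁻¹ * E β))) * D u :=
          mul_le_mul_of_nonneg_right (mul_le_mul_of_nonneg_left (mul_le_mul_of_nonneg_left hav hC0) (by positivity)) (hD0 u)
      _ = |cQ| * Real.exp (kappa163 (3 + 1) / (3 + 1)) * C * (((((m + 1 : ℕ) : ℝ)) ^ 4)⁻¹ * E β) * D u := by rw [← eκ]; ring
      _ = _ := by rw [hDu]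
  -- the block sums
  have hblock : ∀ β, ∑ u ∈ B (n - 1) β, S u ≤ (|cQ| * Real.exp (kappa163 (3 + 1) / (3 + 1)) * C * ((((m + 1 : ℕ) : ℝ)) ^ 4)⁻¹ *
      (2 * (((n : ℕ) : ℝ) ^ 4 * (((n : ℕ) : ℝ) ^ 4 * ((((n : ℕ) : ℝ) - 1) * (((n : ℕ) : ℝ) ^ 4)⁻¹))))) * E β := by
    intro β
    have hDs := sum_B_D_le n κ' hρ β
    calc ∑ u ∈ B (n - 1) β, S u
        ≤ ∑ u ∈ B (n - 1) β, |cQ| * Real.exp (kappa163 (3 + 1) / (3 + 1)) * C * (((((m + 1 : ℕ) : ℝ)) ^ 4)⁻¹ * E β) *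
            ∑ x ∈ B (n - 1) β, ∑ z ∈ B (n - 1) β, (|qJetAt ρ n κ' u β z| + |qJetAt ρ n κ' u β x|) := Finset.sum_le_sum (hS2 β)
      _ = |cQ| * Real.exp (kappa163 (3 + 1) / (3 + 1)) * C * (((((m + 1 : ℕ) : ℝ)) ^ 4)⁻¹ * E β) *
            ∑ u ∈ B (n - 1) β, ∑ x ∈ B (n - 1) β, ∑ z ∈ B (n - 1) β, (|qJetAt ρ n κ' u β z| + |qJetAt ρ n κ' u β x|) := by
          rw [← Finset.mul_sum]
      _ ≤ |cQ| * Real.exp (kappa163 (3 + 1) / (3 + 1)) * C * (((((m + 1 : ℕ) : ℝ)) ^ 4)⁻¹ * E β) *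
            (2 * (((n : ℕ) : ℝ) ^ 4 * (((n : ℕ) : ℝ) ^ 4 * ((((n : ℕ) : ℝ) - 1) * (((n : ℕ) : ℝ) ^ 4)⁻¹)))) :=
          mul_le_mul_of_nonneg_left hDs (by have := hE0 β; positivity)
      _ = _ := by ring
  -- the block regrouping of `S` and of the exponential
  have he : Summable fun u : Site 4 => Real.exp (-r * l1 (u - c)) := summable_exp_shift' hr0 c
  have hEsum : Summable E := (hasSum_blocks (n - 1) he.hasSum).summable
  have hEt : ∑' β, E β = Zl 4 r := by rw [hE, ← tsum_eq_tsum_blocks (n - 1) he, tsum_exp_shift']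
  have hSt : ∑' u, S u = ∑' β, ∑ u ∈ B (n - 1) β, S u := tsum_eq_tsum_blocks (n - 1) hSs
  have hBs : Summable fun β => ∑ u ∈ B (n - 1) β, S u := (hasSum_blocks (n - 1) hSs.hasSum).summable
  set L : ℝ := |cQ| * Real.exp (kappa163 (3 + 1) / (3 + 1)) * C * ((((m + 1 : ℕ) : ℝ)) ^ 4)⁻¹ *
      (2 * (((n : ℕ) : ℝ) ^ 4 * (((n : ℕ) : ℝ) ^ 4 * ((((n : ℕ) : ℝ) - 1) * (((n : ℕ) : ℝ) ^ 4)⁻¹)))) with hL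
  have hL0 : 0 ≤ L := by
    have : (0 : ℝ) ≤ ((n : ℕ) : ℝ) - 1 := by rw [hn]; linarith
    positivity
  have hZ := Zl_kappa_le m
  rw [← hr] at hZ
  have hZ0 : 0 ≤ Zl 4 r := Zl_nonneg hr0
  calc ∑' u, S u = ∑' β, ∑ u ∈ B (n - 1) β, S u := hSt
    _ ≤ ∑' β, L * E β := hBs.tsum_le_tsum hblock (hEsum.mul_left L)
    _ = L * Zl 4 r := by rw [tsum_mul_left, hEt]
    _ = |cQ| * (2 * Real.exp (kappa163 (3 + 1) / (3 + 1))) *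
          (C * ((((n : ℕ) : ℝ) - 1) * ((n : ℕ) : ℝ) ^ 4)) * (((((m + 1 : ℕ) : ℝ)) ^ 4)⁻¹ * Zl 4 r) := by
        rw [hL, hn]; field_simp
    _ ≤ |cQ| * (2 * Real.exp (kappa163 (3 + 1) / (3 + 1))) *
          ((MG163 (3 + 1) * periodConst (kappa163 (3 + 1)) 3) * Real.exp (kappa163 (3 + 1) / (3 + 1))) * (1 + 16 / (kappa163 (3 + 1) / (3 + 1))) ^ 4 := by
        have hMP : 0 ≤ (MG163 (3 + 1) * periodConst (kappa163 (3 + 1)) 3) * Real.exp (kappa163 (3 + 1) / (3 + 1)) := by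
          have h := hC0
          rw [hC, mul_assoc] at h
          exact (mul_nonneg_iff_of_pos_left (inv_pos.2 (pow_pos hn0 (3 + 2)))).1 h
        have hCn : C * ((((n : ℕ) : ℝ) - 1) * ((n : ℕ) : ℝ) ^ 4) ≤ (MG163 (3 + 1) * periodConst (kappa163 (3 + 1)) 3) * Real.exp (kappa163 (3 + 1) / (3 + 1)) := by
          rw [hC, hn]
          have hvol : ((((m + 1 : ℕ) : ℝ)) ^ (3 + 2))⁻¹ * ((((m + 1 : ℕ) : ℝ) - 1) * ((m + 1 : ℕ) : ℝ) ^ 4) ≤ 1 := by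
            rw [inv_mul_le_iff₀ (by positivity), mul_one]
            have e : ((((m + 1 : ℕ) : ℝ)) - 1) * ((m + 1 : ℕ) : ℝ) ^ 4 = (((m + 1 : ℕ) : ℝ)) ^ (3 + 2) - (((m + 1 : ℕ) : ℝ)) ^ 4 := by ring
            rw [e]; linarith [pow_pos hn0 4]
          calc ((((m + 1 : ℕ) : ℝ)) ^ (3 + 2))⁻¹ * (MG163 (3 + 1) * periodConst (kappa163 (3 + 1)) 3) * Real.exp (kappa163 (3 + 1) / (3 + 1)) *
                ((((m + 1 : ℕ) : ℝ) - 1) * ((m + 1 : ℕ) : ℝ) ^ 4)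
              = (((((m + 1 : ℕ) : ℝ)) ^ (3 + 2))⁻¹ * ((((m + 1 : ℕ) : ℝ) - 1) * ((m + 1 : ℕ) : ℝ) ^ 4)) *
                  ((MG163 (3 + 1) * periodConst (kappa163 (3 + 1)) 3) * Real.exp (kappa163 (3 + 1) / (3 + 1))) := by ring
            _ ≤ 1 * ((MG163 (3 + 1) * periodConst (kappa163 (3 + 1)) 3) * Real.exp (kappa163 (3 + 1) / (3 + 1))) :=
                mul_le_mul_of_nonneg_right hvol hMP
            _ = _ := one_mul _
        have h1 : 0 ≤ C * ((((n : ℕ) : ℝ) - 1) * ((n : ℕ) : ℝ) ^ 4) := by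
          have : (0 : ℝ) ≤ ((n : ℕ) : ℝ) - 1 := by rw [hn]; linarith
          positivity
        have h2 : 0 ≤ ((((m + 1 : ℕ) : ℝ)) ^ 4)⁻¹ * Zl 4 r := by positivity
        exact mul_le_mul (mul_le_mul_of_nonneg_left hCn (by positivity)) hZ h2 (by positivity)
    _ = _ := by ring

end StencilSum


end Summit.QuantumFields.BalabanUV.Beta.D1BFx.GhostDeltaJetLetters
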